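import Mathlib.Analysis.Convex.Integral
import Mathlib.Analysis.Convex.SpecificFunctions.Basic
import Mathlib.Probability.Moments.SubGaussian
import Literature.MathematicalPhysics.KineticTheory.HardSphereEulerProofs
import Literature.Analysis.FluidPDE.HardSphereTrajectoryMeasurable
import HarnessLib

/-!
# Window pressures of one-body observables under a flow-invariant hard-sphere Gibbs law are static

Topic `Literature/MathematicalPhysics/KineticTheory`, over the hard-sphere Euler prelude
(`HardSphereEuler`, `HardSphereEulerProofs`: `T3`, `V3`, `hsDiameter`, `localGibbsLaw`,
`localGibbsMeasure`, `gaussMeasure`) and the hard-sphere flow prelude (`HardSphereFlow`,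
`HardSphereFlowJointMeasurable`, `HardSphereTrajectoryMeasurable`).

The finite-`N` **window pressure** of an observable `F` on phase space, for a hard-sphere flow `Φ`, a
window `w > 0` and a law `P`, is `log ∫ exp(w⁻¹ ∫₀ʷ F(Φ_s z) ds) dP(z)` — the exponential-moment
currency of all kinetic-window large-deviation statements of the hydrodynamic-limit programme
(Olla–Varadhan–Yau 1993 §2; Kipnis–Landim 1999 App. 1 §5–6; Spohn 1991 Part I §2.3).  Two STATIC
facts control it for every `N`, every flow and every window:

* **Jensen in time + invariance** (`HardSphereFlow.lintegral_exp_windowAvg_le_of_invariant`): if `P` is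
  carried by the good set of `Φ` and preserved by every `Φ_t`, then
  `∫ exp(w⁻¹∫₀ʷ F(Φ_s z) ds) dP ≤ ∫ exp(F) dP` — pathwise Jensen for `exp` under the normalised
  Lebesgue measure of the window (`ofReal_exp_intervalAverage_le`), Tonelli (the flow is jointly
  measurable on `good × ℝ`, `HardSphereFlow.aemeasurable_comp_flow_prod_torus`), and stationarity of
  each fixed-time moment.  Invariance is a HYPOTHESIS `hstat` here (for the constant-profile local Gibbs
  law it is Liouville + conservation laws, proved problem-side as
  `Theorems.measurePreserving_flow_localGibbsLaw_const`).
* **Gaussian one-site factorisation** (`lintegral_exp_sum_localGibbsMeasure_const_le`): under the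
  homogeneous Gibbs measure `G_N = localGibbsMeasure σ a u θ N` (constant profiles, `σ ≤ 1/2`), given the
  positions the velocities are i.i.d. `N(u, θ id)`, so for a one-body `q` with
  `∫ exp(q(x, v)) N(u,θ)(dv) ≤ C` uniformly in `x`, `∫ exp(∑ᵢ q(xᵢ, vᵢ)) dG_N ≤ C^{N+1}`
  (disintegration `lintegral_localGibbsMeasure`, Tonelli on the velocity product, position marginal of
  mass one).
* Combined (`lintegral_exp_windowAvg_sum_localGibbsLaw_const_le`): the window pressure of
  `∑ᵢ q(xᵢ, vᵢ)` for a continuous one-body `q` (bounded or not: orbits of good points have bounded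
  velocities by energy conservation, `HardSphereFlow.intervalIntegrable_comp_flow_of_continuous`) is at
  most `(N+1) log C`.
* One-site inputs: `lintegral_exp_mul_centred_gaussMeasure_le` — Hoeffding's lemma
  (`ProbabilityTheory.hasSubgaussianMGF_of_mem_Icc_of_integral_eq_zero`) for a centred bounded
  function of the scaled peculiar velocity `w = (v - u)/√θ`, which is standard Gaussian under
  `N(u, θ id)` (`lintegral_gaussMeasure_eq_lintegral_stdGaussian_sv`):
  `∫ exp(t g(w)) ≤ exp(b²t²/2)` for `|g| ≤ b`, `∫ g dγ = 0`.

Design: everything is in the `∫⁻ … ENNReal.ofReal (Real.exp …)` currency of the route items (no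
integrability side conditions); the flow-generic lemmas hold for `HardSphereFlow (Torus.geometry d) ε n`
in every dimension (dot-notation extensions of `Literature.Analysis.FluidPDE.HardSphereFlow`, absolute
names), the Gibbs-specific ones for the `d = 3` prelude of `HardSphereEuler`.  No new definitions.

References: S. Olla, S. R. S. Varadhan, H.-T. Yau, Comm. Math. Phys. 155 (1993) 523–560, §2;
C. Kipnis, C. Landim, *Scaling Limits of Interacting Particle Systems* (1999), App. 1 §5–6
[KipnisLandim1999]; H. Spohn, *Large Scale Dynamics of Interacting Particles* (1991), Part I §2.3
[Spohn1991]; W. Hoeffding, J. Amer. Statist. Assoc. 58 (1963) 13–30, Lemma 1 [Hoeffding1963].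
-/

noncomputable section

namespace Literature.MathematicalPhysics.KineticTheory

open _root_.MeasureTheory _root_.ProbabilityTheory Set Filter
open scoped ENNReal BigOperators
open Literature.Analysis.FluidPDE

/-! ### Jensen in time for the exponential, `lintegral` currency -/

/-- **Jensen in time on an interval**, `lintegral` form: for `a < b` and `g` interval integrable on
`[a, b]`, `exp ((b - a)⁻¹ ∫ₐᵇ g) ≤ (b - a)⁻¹ ∫⁻_{(a,b]} exp g` — Jensen for the convex `exp` under the
normalised Lebesgue measure of the interval (`ConvexOn.map_integral_le`); if `exp ∘ g` is not
integrable the right-hand side is `∞`. [folklore] -/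
theorem ofReal_exp_intervalAverage_le {g : ℝ → ℝ} {a b : ℝ} (hab : a < b)
    (hg : IntervalIntegrable g volume a b) :
    ENNReal.ofReal (Real.exp ((b - a)⁻¹ * ∫ r in a..b, g r)) ≤
      ENNReal.ofReal (b - a)⁻¹ * ∫⁻ r in Ioc a b, ENNReal.ofReal (Real.exp (g r)) := by
  -- adapted from `Theorems/TwoClocksEquilibriumShearWindowLDStatic.lean` and
  -- `Theorems/KineticFluxLdDecay/Negative/TiltBasics.lean` (window `[0, w]`, Jensen separately)
  have hba : 0 < b - a := sub_pos.2 hab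
  set ν : Measure ℝ := ENNReal.ofReal (b - a)⁻¹ • volume.restrict (Ioc a b) with hν
  haveI : IsProbabilityMeasure ν := by
    constructor
    rw [hν, Measure.smul_apply, Measure.restrict_apply_univ, Real.volume_Ioc, smul_eq_mul,
      ← ENNReal.ofReal_mul (inv_nonneg.2 hba.le), inv_mul_cancel₀ hba.ne', ENNReal.ofReal_one]
  have hgν : Integrable g ν := hg.1.integrable.smul_measure ENNReal.ofReal_ne_top
  have h1 : (b - a)⁻¹ * ∫ r in a..b, g r = ∫ r, g r ∂ν := by
    rw [intervalIntegral.integral_of_le hab.le, hν, integral_smul_measure,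
      ENNReal.toReal_ofReal (inv_nonneg.2 hba.le), smul_eq_mul]
  have h2 : ∫⁻ r, ENNReal.ofReal (Real.exp (g r)) ∂ν =
      ENNReal.ofReal (b - a)⁻¹ * ∫⁻ r in Ioc a b, ENNReal.ofReal (Real.exp (g r)) := by
    rw [hν, lintegral_smul_measure, smul_eq_mul]
  rw [h1, ← h2]
  -- Jensen for `exp` under the probability measure `ν`
  have hm : AEStronglyMeasurable (fun x => Real.exp (g x)) ν :=
    Real.continuous_exp.comp_aestronglyMeasurable hgν.aestronglyMeasurable
  by_cases hi : Integrable (fun x => Real.exp (g x)) ν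
  · have hJ : Real.exp (∫ x, g x ∂ν) ≤ ∫ x, Real.exp (g x) ∂ν :=
      (convexOn_exp).map_integral_le Real.continuous_exp.continuousOn isClosed_univ
        (by simp) hgν hi
    rw [← ofReal_integral_eq_lintegral_ofReal hi (ae_of_all _ fun x => (Real.exp_pos _).le)]
    exact ENNReal.ofReal_le_ofReal hJ
  · have htop : ∫⁻ x, ENNReal.ofReal (Real.exp (g x)) ∂ν = ∞ := by
      have h3 : ¬ HasFiniteIntegral (fun x => Real.exp (g x)) ν := fun h => hi ⟨hm, h⟩
      rw [hasFiniteIntegral_iff_enorm, not_lt, top_le_iff] at h3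
      rw [← h3]
      refine lintegral_congr fun x => ?_
      rw [Real.enorm_eq_ofReal (Real.exp_pos _).le]
    rw [htop]
    exact le_top

/-! ### Hard-sphere flows on the torus: joint measurability and orbit integrability -/

section Flow

variable {d : Type*} [Fintype d] {ε : ℝ} {n : ℕ}

/-- **Observables evaluated along the flow are a.e.-measurable on `phase space × time`.** For a
hard-sphere flow `Φ` on `𝕋^d`, a measure `μ` on phase space carried by the good set, an s-finite
measure `ν` on `ℝ` and a measurable `H`, the map `(z, r) ↦ H (Φ_r z)` is `μ ⊗ ν`-a.e. measurable (it is
measurable on `Φ.good × ℝ` by `HardSphereFlow.measurable_flow_prod_torus`; modify it to a constant off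
that conull measurable set).  Dot-notation extension of `Literature.Analysis.FluidPDE.HardSphereFlow`.
[folklore] -/
theorem _root_.Literature.Analysis.FluidPDE.HardSphereFlow.aemeasurable_comp_flow_prod_torus
    (Φ : HardSphereFlow (Torus.geometry d) ε n) {μ : Measure (Config n d (UnitAddTorus d))}
    (hμ : μ Φ.goodᶜ = 0) (ν : Measure ℝ) [SFinite ν] {β : Type*} [MeasurableSpace β] (b₀ : β)
    {H : Config n d (UnitAddTorus d) → β} (hH : Measurable H) :
    AEMeasurable (fun p : Config n d (UnitAddTorus d) × ℝ => H (Φ.flow p.2 p.1)) (μ.prod ν) := by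
  classical
  -- adapted from `Theorems/TwoClocksEquilibriumShearWindowLDStatic.lean`
  set S : Set (Config n d (UnitAddTorus d) × ℝ) := Φ.good ×ˢ (univ : Set ℝ) with hS
  have hSm : MeasurableSet S := Φ.measurableSet_good.prod MeasurableSet.univ
  have hflowS : Measurable fun p : S => H (Φ.flow p.1.2 p.1.1) := by
    have hmk : Measurable fun p : S => ((⟨p.1.1, (mem_prod.1 p.2).1⟩ : Φ.good), p.1.2) :=
      ((measurable_fst.comp measurable_subtype_coe).subtype_mk).prodMk
        (measurable_snd.comp measurable_subtype_coe)
    exact hH.comp ((Φ.measurable_flow_prod_torus).comp hmk)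
  set G : Config n d (UnitAddTorus d) × ℝ → β := fun p =>
    if hp : p ∈ S then H (Φ.flow p.2 p.1) else b₀ with hG
  have hGm : Measurable G := by
    have := Measurable.dite (s := S) (f := fun p : S => H (Φ.flow p.1.2 p.1.1))
      (g := fun _ => b₀) hflowS measurable_const hSm
    convert this using 1
  have hSc : (μ.prod ν) Sᶜ = 0 := by
    have hsub : Sᶜ ⊆ Φ.goodᶜ ×ˢ (univ : Set ℝ) := by
      intro p hp
      simp only [hS, mem_compl_iff, mem_prod, mem_univ, and_true] at hp
      exact ⟨hp, mem_univ _⟩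
    refine measure_mono_null hsub ?_
    rw [Measure.prod_prod, hμ, zero_mul]
  refine ⟨G, hGm, ae_iff.2 (measure_mono_null (fun p hp => ?_) hSc)⟩
  exact fun hpS => hp (by simp only [hG, hpS, dite_true])

/-- A bounded measurable observable is interval integrable along every good orbit of a hard-sphere
flow on `𝕋^d` (the orbit is measurable in time, `IsHardSphereTrajectory.measurable_torus`).
Dot-notation extension of `Literature.Analysis.FluidPDE.HardSphereFlow`. [folklore] -/
theorem _root_.Literature.Analysis.FluidPDE.HardSphereFlow.intervalIntegrable_comp_flow_of_bounded
    (Φ : HardSphereFlow (Torus.geometry d) ε n) {z : Config n d (UnitAddTorus d)} (hz : z ∈ Φ.good)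
    {F : Config n d (UnitAddTorus d) → ℝ} (hF : Measurable F) {C : ℝ} (hC : ∀ w, |F w| ≤ C)
    (a b : ℝ) : IntervalIntegrable (fun s => F (Φ.flow s z)) volume a b := by
  have hm : Measurable fun s => F (Φ.flow s z) :=
    hF.comp (Φ.isTrajectory z hz).measurable_torus
  exact (intervalIntegrable_const (c := C)).mono_fun' hm.aestronglyMeasurable
    (ae_of_all _ fun s => by simpa only [Real.norm_eq_abs] using hC (Φ.flow s z))

/-- A CONTINUOUS observable (bounded or not) is interval integrable along every good orbit of a
hard-sphere flow on `𝕋^d`: the orbit is measurable in time and stays in the compact set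
`{positions in 𝕋^d, all speeds ≤ √(2E(z))}` by conservation of the kinetic energy
(`IsHardSphereTrajectory.configEnergy_eq_holds`).  Dot-notation extension of
`Literature.Analysis.FluidPDE.HardSphereFlow`. [folklore] -/
theorem _root_.Literature.Analysis.FluidPDE.HardSphereFlow.intervalIntegrable_comp_flow_of_continuous
    (Φ : HardSphereFlow (Torus.geometry d) ε n) {z : Config n d (UnitAddTorus d)} (hz : z ∈ Φ.good)
    {F : Config n d (UnitAddTorus d) → ℝ} (hF : Continuous F) (a b : ℝ) :
    IntervalIntegrable (fun s => F (Φ.flow s z)) volume a b := by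
  have hm : Measurable fun s => F (Φ.flow s z) :=
    hF.measurable.comp (Φ.isTrajectory z hz).measurable_torus
  set K : Set (Config n d (UnitAddTorus d)) := Set.pi univ fun _ =>
    (univ : Set (UnitAddTorus d)) ×ˢ
      Metric.closedBall (0 : EuclideanSpace ℝ d) (Real.sqrt (2 * configEnergy z)) with hK
  have hKc : IsCompact K :=
    isCompact_univ_pi fun _ => isCompact_univ.prod (isCompact_closedBall _ _)
  have hE : ∀ s, configEnergy (Φ.flow s z) = configEnergy z := fun s => by
    have h := IsHardSphereTrajectory.configEnergy_eq_holds (Φ.isTrajectory z hz) s 0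
    rwa [Φ.flow_zero z hz] at h
  have hmem : ∀ s, Φ.flow s z ∈ K := by
    intro s i _
    refine ⟨mem_univ _, ?_⟩
    rw [Metric.mem_closedBall, dist_zero_right]
    refine Real.le_sqrt_of_sq_le ?_
    rw [← hE s]
    have h : ‖(Φ.flow s z i).2‖ ^ 2 ≤ ∑ j, ‖(Φ.flow s z j).2‖ ^ 2 :=
      Finset.single_le_sum (f := fun j => ‖(Φ.flow s z j).2‖ ^ 2) (fun j _ => sq_nonneg _)
        (Finset.mem_univ i)
    unfold configEnergy
    linarith
  obtain ⟨B, hB⟩ := hKc.exists_bound_of_continuousOn hF.continuousOn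
  exact (intervalIntegrable_const (c := B)).mono_fun' hm.aestronglyMeasurable
    (ae_of_all _ fun s => hB _ (hmem s))

/-! ### Jensen in time + invariance -/

/-- **Window exponential moments are dominated by the static one (Jensen in time + invariance).**
For a hard-sphere flow `Φ` on `𝕋^d`, an s-finite law `P` on phase space CARRIED BY THE GOOD SET and
PRESERVED BY EVERY `Φ_t`, a measurable observable `F` interval integrable along good orbits, and a
window `w > 0`:
`∫⁻ exp(w⁻¹ ∫₀ʷ F(Φ_s z) ds) dP ≤ ∫⁻ exp(F z) dP`.
Pathwise Jensen on the good set (`ofReal_exp_intervalAverage_le`), Tonelli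
(`HardSphereFlow.aemeasurable_comp_flow_prod_torus`), and `∫⁻ exp F ∘ Φ_s dP = ∫⁻ exp F dP` for each
`s` (`MeasurePreserving.lintegral_comp`).  Dot-notation extension of
`Literature.Analysis.FluidPDE.HardSphereFlow`. [folklore] -/
theorem _root_.Literature.Analysis.FluidPDE.HardSphereFlow.lintegral_exp_windowAvg_le_of_invariant
    (Φ : HardSphereFlow (Torus.geometry d) ε n) (P : Measure (Config n d (UnitAddTorus d)))
    [SFinite P] (hP : P Φ.goodᶜ = 0) (hstat : ∀ t : ℝ, MeasurePreserving (Φ.flow t) P P)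
    {F : Config n d (UnitAddTorus d) → ℝ} (hF : Measurable F) {w : ℝ} (hw : 0 < w)
    (hFi : ∀ z ∈ Φ.good, IntervalIntegrable (fun s => F (Φ.flow s z)) volume 0 w) :
    ∫⁻ z, ENNReal.ofReal (Real.exp (w⁻¹ * ∫ s in (0 : ℝ)..w, F (Φ.flow s z))) ∂P ≤
      ∫⁻ z, ENNReal.ofReal (Real.exp (F z)) ∂P := by
  -- adapted from `lintegral_exp_windowSum_le_static`, `Theorems/TwoClocksEquilibriumShearWindowLDStatic.lean`
  set H : Config n d (UnitAddTorus d) → ℝ≥0∞ := fun z => ENNReal.ofReal (Real.exp (F z)) with hH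
  have hHm : Measurable H := hF.exp.ennreal_ofReal
  have hpt : ∀ z ∈ Φ.good,
      ENNReal.ofReal (Real.exp (w⁻¹ * ∫ s in (0 : ℝ)..w, F (Φ.flow s z))) ≤
        ENNReal.ofReal w⁻¹ * ∫⁻ s in Ioc 0 w, H (Φ.flow s z) :=
    fun z hz => by simpa only [sub_zero] using ofReal_exp_intervalAverage_le hw (hFi z hz)
  have hae : ∀ᵐ z ∂P, z ∈ Φ.good := by
    have h := compl_mem_ae_iff.2 hP
    rwa [compl_compl] at h
  have hswap : AEMeasurable (Function.uncurry fun (z : Config n d (UnitAddTorus d)) (s : ℝ) =>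
      H (Φ.flow s z)) (P.prod (volume.restrict (Ioc 0 w))) :=
    Φ.aemeasurable_comp_flow_prod_torus hP _ (0 : ℝ≥0∞) hHm
  have hinv : ∀ s, ∫⁻ z, H (Φ.flow s z) ∂P = ∫⁻ z, H z ∂P := fun s =>
    (hstat s).lintegral_comp hHm
  calc ∫⁻ z, ENNReal.ofReal (Real.exp (w⁻¹ * ∫ s in (0 : ℝ)..w, F (Φ.flow s z))) ∂P
      ≤ ∫⁻ z, ENNReal.ofReal w⁻¹ * (∫⁻ s in Ioc 0 w, H (Φ.flow s z)) ∂P := by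
        refine lintegral_mono_ae ?_
        filter_upwards [hae] with z hz using hpt z hz
    _ = ENNReal.ofReal w⁻¹ * ∫⁻ s in Ioc 0 w, (∫⁻ z, H (Φ.flow s z) ∂P) := by
        rw [lintegral_const_mul' _ _ ENNReal.ofReal_ne_top, lintegral_lintegral_swap hswap]
    _ = ENNReal.ofReal w⁻¹ * ∫⁻ _s in Ioc (0 : ℝ) w, (∫⁻ z, H z ∂P) := by
        simp_rw [hinv]
    _ = ∫⁻ z, H z ∂P := by
        rw [setLIntegral_const, Real.volume_Ioc, sub_zero, mul_left_comm,
          ← ENNReal.ofReal_mul (inv_nonneg.2 hw.le), inv_mul_cancel₀ hw.ne', ENNReal.ofReal_one,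
          mul_one]

end Flow

/-! ### Gaussian one-site factorisation of the homogeneous Gibbs measure -/

/-- **Exponential moments of one-body sums factorise under the homogeneous Gibbs measure.** For
constant profiles `a > 0`, `θ > 0`, `u` and reduced diameter `σ ≤ 1/2` (so that
`G_N = localGibbsMeasure σ a u θ N` is a probability measure), a measurable one-body `q` on
`𝕋³ × ℝ³` and a bound `∫⁻ exp(q(x, v)) N(u, θ id)(dv) ≤ C` uniform in `x`:
`∫⁻ exp(∑ᵢ q(xᵢ, vᵢ)) dG_N ≤ C^{N+1}` — conditionally on the positions the velocities are i.i.d.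
`N(u, θ id)` (`lintegral_localGibbsMeasure`), Tonelli on the velocity product
(`lintegral_fintype_prod_eq_prod'`), and the position marginal has mass one
(`lintegral_posWeight_eq_one`). [folklore] -/
theorem lintegral_exp_sum_localGibbsMeasure_const_le {a θ : ℝ} (ha : 0 < a) (hθ : 0 < θ) (u : V3)
    {σ : ℝ} (hσ2 : σ ≤ 1 / 2) (N : ℕ) {q : T3 × V3 → ℝ} (hq : Measurable q) {C : ℝ≥0∞}
    (hC : ∀ x : T3, ∫⁻ v, ENNReal.ofReal (Real.exp (q (x, v))) ∂(gaussMeasure u θ) ≤ C) :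
    ∫⁻ z, ENNReal.ofReal (Real.exp (∑ i, q (z i)))
        ∂(localGibbsMeasure σ (fun _ => a) (fun _ => u) (fun _ => θ) N) ≤ C ^ (N + 1) := by
  haveI := isProbabilityMeasure_localGibbsMeasure (a₀ := fun _ => a) (θ₀ := fun _ => θ)
    (u₀ := fun _ => u) continuous_const continuous_const continuous_const (fun _ => ha)
    (fun _ => hθ) hσ2 N
  have hGm : Measurable fun z : Config (N + 1) (Fin 3) T3 =>
      ENNReal.ofReal (Real.exp (∑ i, q (z i))) :=
    (Finset.measurable_sum _ fun i _ => hq.comp (measurable_pi_apply i)).exp.ennreal_ofReal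
  have hq1 : ∀ x : T3, Measurable fun v : V3 => ENNReal.ofReal (Real.exp (q (x, v))) := fun x =>
    (hq.comp (measurable_const.prodMk measurable_id)).exp.ennreal_ofReal
  have hvel : ∀ x : Fin (N + 1) → T3,
      ∫⁻ v, ENNReal.ofReal (Real.exp (∑ i, q (zipConfig (x, v) i)))
          ∂velMeasure (fun _ => u) (fun _ => θ) x ≤ C ^ (N + 1) := by
    intro x
    have hprod : ∀ v : Fin (N + 1) → V3, ENNReal.ofReal (Real.exp (∑ i, q (zipConfig (x, v) i))) =
        ∏ i, ENNReal.ofReal (Real.exp (q (x i, v i))) := fun v => by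
      rw [Real.exp_sum, ENNReal.ofReal_prod_of_nonneg fun i _ => (Real.exp_pos _).le]
      rfl
    simp_rw [hprod]
    rw [velMeasure, lintegral_fintype_prod_eq_prod' (fun _ : Fin (N + 1) => gaussMeasure u θ)
      (f := fun i v => ENNReal.ofReal (Real.exp (q (x i, v)))) fun i => hq1 (x i)]
    exact (Finset.prod_le_prod' fun i _ => hC (x i)).trans_eq (by simp)
  have hρm : Measurable fun x : Fin (N + 1) → T3 => ENNReal.ofReal
      ((canonicalPartition (Torus.geometry (Fin 3)) (hsDiameter σ N) (N + 1)
        (localGibbsProfile (fun _ => a) (fun _ => u) (fun _ => θ)))⁻¹ *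
          posWeight (fun _ => a) (hsDiameter σ N) (N + 1) x) :=
    (measurable_const.mul (measurable_posWeight continuous_const _ _)).ennreal_ofReal
  rw [lintegral_localGibbsMeasure continuous_const continuous_const continuous_const
    (fun _ => ha.le) (fun _ => hθ) σ N hGm]
  calc ∫⁻ x, ENNReal.ofReal ((canonicalPartition (Torus.geometry (Fin 3)) (hsDiameter σ N) (N + 1)
          (localGibbsProfile (fun _ => a) (fun _ => u) (fun _ => θ)))⁻¹ *
            posWeight (fun _ => a) (hsDiameter σ N) (N + 1) x) *
          ∫⁻ v, ENNReal.ofReal (Real.exp (∑ i, q (zipConfig (x, v) i)))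
            ∂velMeasure (fun _ => u) (fun _ => θ) x
      ≤ ∫⁻ x, ENNReal.ofReal ((canonicalPartition (Torus.geometry (Fin 3)) (hsDiameter σ N) (N + 1)
          (localGibbsProfile (fun _ => a) (fun _ => u) (fun _ => θ)))⁻¹ *
            posWeight (fun _ => a) (hsDiameter σ N) (N + 1) x) * C ^ (N + 1) :=
        lintegral_mono fun x => mul_le_mul' le_rfl (hvel x)
    _ = C ^ (N + 1) := by
        rw [lintegral_mul_const _ hρm, lintegral_posWeight_eq_one continuous_const continuous_const
          continuous_const (fun _ => ha.le) (fun _ => hθ) σ N, one_mul]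

/-- **The window pressure of a one-body observable under an invariant homogeneous Gibbs law is at
most `(N+1) log C`.** For constant profiles `a > 0`, `θ > 0`, `u`, `σ ≤ 1/2`, a hard-sphere flow `Φ`
of `N + 1` spheres of diameter `σ(N+1)^{-1/3}` on `𝕋³` preserving `G_N = localGibbsLaw σ a u θ N Φ`
(hypothesis `hstat`; Liouville + conservation laws), a continuous one-body `q` with
`∫⁻ exp(q(x, v)) N(u, θ id)(dv) ≤ C` for all `x`, and a window `w > 0`:
`∫⁻ exp(w⁻¹ ∫₀ʷ ∑ᵢ q(Φ_s z i) ds) dG_N ≤ C^{N+1}`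
(`HardSphereFlow.lintegral_exp_windowAvg_le_of_invariant` + `lintegral_exp_sum_localGibbsMeasure_const_le`).
[folklore] -/
theorem lintegral_exp_windowAvg_sum_localGibbsLaw_const_le {a θ : ℝ} (ha : 0 < a) (hθ : 0 < θ)
    (u : V3) {σ : ℝ} (hσ2 : σ ≤ 1 / 2) (N : ℕ)
    (Φ : HardSphereFlow (Torus.geometry (Fin 3)) (hsDiameter σ N) (N + 1))
    (hstat : ∀ t : ℝ, MeasurePreserving (Φ.flow t)
      (localGibbsLaw σ (fun _ => a) (fun _ => u) (fun _ => θ) N Φ)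
      (localGibbsLaw σ (fun _ => a) (fun _ => u) (fun _ => θ) N Φ))
    {q : T3 × V3 → ℝ} (hq : Continuous q) {C : ℝ≥0∞}
    (hC : ∀ x : T3, ∫⁻ v, ENNReal.ofReal (Real.exp (q (x, v))) ∂(gaussMeasure u θ) ≤ C)
    {w : ℝ} (hw : 0 < w) :
    ∫⁻ z, ENNReal.ofReal (Real.exp (w⁻¹ * ∫ s in (0 : ℝ)..w, ∑ i, q (Φ.flow s z i)))
        ∂(localGibbsLaw σ (fun _ => a) (fun _ => u) (fun _ => θ) N Φ) ≤ C ^ (N + 1) := by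
  set P := localGibbsLaw σ (fun _ => a) (fun _ => u) (fun _ => θ) N Φ with hP
  haveI : IsProbabilityMeasure P := isProbabilityMeasure_localGibbsLaw continuous_const
    continuous_const continuous_const (fun _ => ha) (fun _ => hθ) hσ2 N Φ
  have hF : Continuous fun z : Config (N + 1) (Fin 3) T3 => ∑ i, q (z i) :=
    continuous_finsetSum _ fun i _ => hq.comp (continuous_apply i)
  have hgood : P Φ.goodᶜ = 0 :=
    (withDensity_absolutelyContinuous _ _ :
      P ≪ liouville (Torus.geometry (Fin 3)) (N + 1) (hsDiameter σ N)) Φ.measure_compl_good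
  calc ∫⁻ z, ENNReal.ofReal (Real.exp (w⁻¹ * ∫ s in (0 : ℝ)..w, ∑ i, q (Φ.flow s z i))) ∂P
      ≤ ∫⁻ z, ENNReal.ofReal (Real.exp (∑ i, q (z i))) ∂P :=
        Φ.lintegral_exp_windowAvg_le_of_invariant P hgood hstat
          hF.measurable hw fun z hz => Φ.intervalIntegrable_comp_flow_of_continuous hz hF 0 w
    _ ≤ C ^ (N + 1) := by
        rw [hP, localGibbsLaw_eq]
        exact lintegral_exp_sum_localGibbsMeasure_const_le ha hθ u hσ2 N hq.measurable hC

/-! ### One-site bounds: the scaled peculiar velocity is standard Gaussian -/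

/-- **Under `N(u, θ id)` the scaled peculiar velocity `w = (v - u)/√θ` is standard Gaussian**
(`lintegral` transfer form): `∫⁻ f((v - u)/√θ) N(u, θ id)(dv) = ∫⁻ f dγ` for measurable `f ≥ 0` and
`θ > 0` (`gaussMeasure u θ` is the image of `γ = stdGaussian` under `w ↦ u + √θ w`). [folklore] -/
theorem lintegral_gaussMeasure_eq_lintegral_stdGaussian_sv {θ : ℝ} (hθ : 0 < θ) (u : V3)
    {f : V3 → ℝ≥0∞} (hf : Measurable f) :
    ∫⁻ v, f ((Real.sqrt θ)⁻¹ • (v - u)) ∂(gaussMeasure u θ) = ∫⁻ w, f w ∂(stdGaussian V3) := by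
  have hsv : Measurable fun v : V3 => (Real.sqrt θ)⁻¹ • (v - u) := by fun_prop
  have h := lintegral_map (μ := stdGaussian V3) (hf.comp hsv) (measurable_gaussShift u θ)
  rw [gaussMeasure]
  refine h.trans (lintegral_congr fun w => ?_)
  have hs : Real.sqrt θ ≠ 0 := (Real.sqrt_pos.2 hθ).ne'
  simp only [Function.comp_apply, add_sub_cancel_left, smul_smul, inv_mul_cancel₀ hs, one_smul]

/-- **Hoeffding's one-site bound for a centred bounded function of the scaled velocity.** For
`θ > 0`, a measurable `g : ℝ³ → ℝ` with `|g| ≤ b` and `∫ g dγ = 0` (`γ` the standard Gaussian), and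
every real `t`: `∫⁻ exp(t · g((v - u)/√θ)) N(u, θ id)(dv) ≤ exp(b² t² / 2)` — the scaled velocity is
`γ`-distributed (`lintegral_gaussMeasure_eq_lintegral_stdGaussian_sv`) and `g` is sub-Gaussian with
parameter `((b - (-b))/2)² = b²` (Hoeffding's lemma,
`ProbabilityTheory.hasSubgaussianMGF_of_mem_Icc_of_integral_eq_zero`). [cite: Hoeffding1963, Lemma 1] -/
theorem lintegral_exp_mul_centred_gaussMeasure_le {θ : ℝ} (hθ : 0 < θ) (u : V3) {g : V3 → ℝ}
    (hg : Measurable g) {b : ℝ} (hgb : ∀ v, |g v| ≤ b) (hg0 : ∫ w, g w ∂(stdGaussian V3) = 0)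
    (t : ℝ) :
    ∫⁻ v, ENNReal.ofReal (Real.exp (t * g ((Real.sqrt θ)⁻¹ • (v - u)))) ∂(gaussMeasure u θ) ≤
      ENNReal.ofReal (Real.exp (b ^ 2 * t ^ 2 / 2)) := by
  have hb : 0 ≤ b := (abs_nonneg _).trans (hgb 0)
  rw [lintegral_gaussMeasure_eq_lintegral_stdGaussian_sv hθ u
    (f := fun w => ENNReal.ofReal (Real.exp (t * g w))) (hg.const_mul t).exp.ennreal_ofReal]
  have hmem : ∀ᵐ w ∂(stdGaussian V3), g w ∈ Set.Icc (-b) b :=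
    ae_of_all _ fun w => abs_le.1 (hgb w)
  have hsg := hasSubgaussianMGF_of_mem_Icc_of_integral_eq_zero hg.aemeasurable hmem hg0
  have hint : Integrable (fun w => Real.exp (t * g w)) (stdGaussian V3) := hsg.integrable_exp_mul t
  rw [← ofReal_integral_eq_lintegral_ofReal hint (ae_of_all _ fun w => (Real.exp_pos _).le)]
  refine ENNReal.ofReal_le_ofReal ?_
  have h := hsg.mgf_le t
  have hc : (((‖b - -b‖₊ / 2) ^ 2 : NNReal) : ℝ) = b ^ 2 := by
    have h2 : ‖b - -b‖₊ = Real.toNNReal (2 * b) := by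
      rw [sub_neg_eq_add, ← two_mul]
      ext
      rw [coe_nnnorm, Real.norm_eq_abs, abs_of_nonneg (by positivity),
        Real.coe_toNNReal _ (by positivity)]
    rw [h2]
    push_cast
    rw [Real.coe_toNNReal _ (by positivity)]
    ring
  rw [hc] at h
  simpa only [mgf] using h

end Literature.MathematicalPhysics.KineticTheory

end
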